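import Literature.Computability.QuantumComplexity.OracleSeparations
import Literature.Computability.Complexity.PolyHierarchy
import HarnessLib

/-!
# The polynomial hierarchy is infinite relative to a random oracle (Rossman–Servedio–Tan 2015, Thm. 2)

Trunk `CplxCore` (relativized polynomial hierarchy, `PolyHierarchy.lean`: `SigmaPRel O k = Σₖᵖ,ᴼ`),
with the random oracle of `QuantumComplexity/OracleSeparations.lean` (`randomOracleMeasure`:
Mathlib's `setBer(univ, 1/2)` on `Set (List Bool)`, samples read as `Language Bool`).

**The printed result.** B. Rossman, R. A. Servedio, L.-Y. Tan, *An average-case depth hierarchy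
theorem for Boolean circuits*, FOCS 2015 (arXiv:1504.03398; journal version with J. Håstad,
J. ACM 64 (2017)) [RossmanServedioTan2015], **Theorem 2** (arXiv numbering; p. 3 and §2.3
p. 7): "The polynomial hierarchy is infinite relative to a random oracle: with probability `1`,
a random oracle `A` satisfies `Σ_d^{P,A} ⊊ Σ_{d+1}^{P,A}` for all `d ∈ ℕ`." It is derived from
their average-case depth hierarchy theorem (Thm. 1: depth-`(d-1)` circuits of size
`2^{n^{1/(6(d-1))}}` agree with the depth-`d` Sipser function on at most `(1/2 + n^{-Ω(1/d)})·2ⁿ`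
inputs) "via a classical connection between small-depth computation and the polynomial hierarchy
[FSS81, Sipser 1983]" (for the derivation the paper refers to Ch. 7 of Håstad's thesis). This
answers "Meyer's question for random oracles" (Håstad 1986; Cai 1986; Babai 1987); the worst-case
form — some oracle relative to which `PH` is infinite — is Håstad's (1986) answer to Meyer's
question (§2.2, p. 6).

**This file** vendors Theorem 2 as the named fact `rossmanServedioTan2015_thm2` (typed as
printed: almost surely, strict inclusions `⊂` at every level) and proves its two standard
readings: almost surely no two consecutive levels of `PH^A` coincide
(`rossmanServedioTan2015_thm2.ae_ne`), and Meyer's question has an affirmative answer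
(`rossmanServedioTan2015_thm2.exists_oracle`: some `A` with `Σ_d^A ⊊ Σ_{d+1}^A` for all `d`).
**The fact is PROVED in the tree**: `rossmanServedioTan2015_thm2_holds`
(`RandomOraclePHHolds.lean`) is the derivation "Thm. 2 from Thm. 1"
(`rossmanServedioTan2015_thm2_of_inRegime`, `RandomOraclePHProofs.lean`: the Furst–Saxe–Sipser /
Sipser / Håstad Ch. 7 connection, with `RandomOraclePHSipser*.lean`,
`RandomOraclePHAsymptotics.lean`, `QuantumComplexity/RandomOracleIndependence.lean`) applied to
the tree's proof `rossmanServedioTan2015_thm1_inRegime_holds` of the average-case depth hierarchy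
theorem (Thm. 1 in the regime of Lemma 7.1; RST §7–§11, files `AverageCaseDepthHierarchy*.lean`);
the closed readings `ae_isInfinitePHRel_randomOracle` (a.s. `∀ k, Σₖ^A ≠ Σₖ₊₁^A`) and
`exists_oracle_sigmaPRel_ssubset_succ` are there too. This head file keeps only the statement
(no heavy imports) for its consumers: the barrier entry `Literature/Barriers/QuantumAdvantage/SupremacyTheoremsNonRelativizing.lean`
(Aaronson–Chen 2017, §5.4, use Thm. 1 of this paper to make `PH^{TQBF ⊕ O}` infinite) and
`RandomOracleMethod.lean`.

## Sources

* [RossmanServedioTan2015] arXiv:1504.03398, read via `lit read arxiv:1504.03398 --pages 3,6-7`: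
  Thm. 1 and Thm. 2 (p. 3), §2.2 (Meyer's question; Håstad 1986 answers it for all `d`, p. 6),
  §2.3 Thm. 2 restated and its derivation from Thm. 1 via Håstad's thesis Ch. 7 (p. 7).
-/

noncomputable section

namespace Literature.Computability.Complexity

open MeasureTheory QuantumComplexity

/-- **Rossman–Servedio–Tan 2015, Thm. 2** (arXiv numbering): "with probability `1`, a random
oracle `A` satisfies `Σ_d^{P,A} ⊊ Σ_{d+1}^{P,A}` for all `d ∈ ℕ`" — over the tree's
`randomOracleMeasure` (uniformly random language) and relativized levels `SigmaPRel`.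
[cite: RossmanServedioTan2015, Thm. 2 (arXiv:1504.03398 p. 3; §2.3 p. 7)] -/
def rossmanServedioTan2015_thm2 : Prop :=
  ∀ᵐ (A : Set (List Bool)) ∂randomOracleMeasure, ∀ d : ℕ,
    SigmaPRel (Oracle.ofLanguage A) d ⊂ SigmaPRel (Oracle.ofLanguage A) (d + 1)

/-- Almost surely no two consecutive levels of the relativized hierarchy coincide (the form
"`PH^A` is infinite" used by Aaronson–Chen 2017, §5). [cite: RossmanServedioTan2015, Thm. 2 (arXiv numbering)] -/
theorem rossmanServedioTan2015_thm2.ae_ne (h : rossmanServedioTan2015_thm2) :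
    ∀ᵐ (A : Set (List Bool)) ∂randomOracleMeasure, ∀ d : ℕ,
      SigmaPRel (Oracle.ofLanguage A) d ≠ SigmaPRel (Oracle.ofLanguage A) (d + 1) :=
  h.mono fun _ hA d => (hA d).ne

/-- **Meyer's question, affirmatively** (Håstad 1986; here read off the probability-one
statement: a full-measure event of a probability measure is nonempty): there is an oracle `A`
with `Σ_d^{P,A} ⊊ Σ_{d+1}^{P,A}` for all `d`. [cite: RossmanServedioTan2015, §2.2 (p. 6) and Thm. 2] -/
theorem rossmanServedioTan2015_thm2.exists_oracle (h : rossmanServedioTan2015_thm2) :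
    ∃ A : Language Bool, ∀ d : ℕ,
      SigmaPRel (Oracle.ofLanguage A) d ⊂ SigmaPRel (Oracle.ofLanguage A) (d + 1) :=
  h.exists

end Literature.Computability.Complexity

end
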